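import Summits.QuantumFields.YangMills.Theorems.BalabanUVNodesN07ChartLogAnalytic
import HarnessLib

/-!
# K0⁷ STUB 1 (`stub_prop8StepCoP13`), sub-target S4b «the (δ∕δA′)V pieces at objects» — THE CHART BLOCK OF THE SECT. F CAPSTONE AT THE RECORD, part 4:
# **THE AVERAGING LETTER `q` OF THE CAPSTONE FOR THE TRUE LINEARISED CONSTRAINT `Qlin = D(chartLog η D)(0)`, k-UNIFORM** — `‖Qlin A′ (j, c)‖ ≤ 240ℓL·r` whenever
# `w₁(b)‖A′ b‖ ≤ r` at every bond (`ℓ = (d+2)L`): the capstone's hypothesis `hQ` («the average: `q·r`») at `Q := Qlin`, block weight `1`, `q = 240ℓL`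

Cell `pub-ymgap`, width seat `pub-ymgap-k0-s1-w2` g3 (CLAIM-1 follow-up, INTENT-4).  `--kind proof --supports stmt-QuantumFields-20541 --as helper`; count-neutral.
[15] = [Balaban1985Variational].

WHY.  After parts 1–3 (`K0Stub1TransposesByDualiser`, `K0Stub1ChartDAnalytic`, `K0Stub1SectFChartBlockAtRecord`) the W-slot `hWq` of the capstone
`K0Stub1SectFWSlotOneLevel.exists_sectF_W_levOf` at the record's TRUE constraint displays LETTERS only; one of them, `hQ : ∀ A′ r, (∀ b, w 1 b·‖A′ b‖ ≤ r) → ∀ i,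
wB i·‖Q A′ i‖ ≤ q·r`, is a property of the linearised average alone.  For `Q := Qlin = fderiv ℂ (chartLog η D) 0` it follows from dag-n07-w2's k-UNIFORM sup bound of the
charted constraint on the weighted ball (`N07ChartRemainderP.norm_chartLog_le_weightedBall`: `‖chartLog η D A (j,c)‖ ≤ 120ℓL·R` on the ball of radius `R`, `12800ℓ²LR ≤ 1`) by
differentiating along the complex line `s ↦ s·A′` at `s = 0`: `chartLog η D 0 = 0`, the radius may be taken `R_s = |s|(2r + |s|) → 0`, so the difference quotient is bounded by
`120ℓL(2r + |s|) → 240ℓL·r`.  (Print: «L^jηQ_j» is a convex combination of parallel transports, (45) p. 285; the tree's `Qlin` is the `linAvg` tower `η·Q^{(j)}` of the route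
`UnitScaleTilt`'s `Prop8ChartDeriv.fderiv_chartLog_zero_apply`, whose comb correction costs the constant.)

WHAT IS PROVED (sorry-free; no definition; axioms standard; any complete normed `ℂ`-algebra fibre `𝔸` with `‖1‖ = 1`; generic carrier `P`).
* ★★ `norm_fderiv_chartLog_zero_apply_le` — nested family `D` with `D.k = k` and the collar property, weights `IsLevWeight P k D w`: for every `A′` and `r` with
  `w 1 b·‖A′ b‖ ≤ r` at every bond, `‖(fderiv ℂ (chartLog η D) 0) A′ idx‖ ≤ 240ℓL·r` at every index (`η = L^{−k}`); `…_of_adm22` (collar from `Adm22 D R′ M`, `2L ≤ R′M + 1`).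
* ★★ `letterQ_Qlin_of_adm22` — THE CAPSTONE's `hQ` VERBATIM at `Q := Qlin`, block weight `1`, `q := 240ℓL`:
  `∀ A′ r, (∀ b, w 1 b·‖A′ b‖ ≤ r) → ∀ i, 1·‖Qlin A′ i‖ ≤ (240ℓL)·r`.
HONEST SCOPE.  One displayed letter of the capstone discharged for the true linearised average; the others ((3.132) `O₁`, `q₀`, `θ₀` = (73)ᵀ, `h₀` = (46)ᵀ, the gradient half
(58) of `ℓ`) stay displayed; nothing of [15] Sects. D–F asserted; `stub_prop8StepCoP13` ∕ K0⁷ NOT closed; N07 NOT discharged; counts unmoved (28∕28 · 5∕27); one finite 𝕋⁴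
programme at fixed ε — R4 closes the conditional finite-𝕋⁴ rung `BalabanLadder.UV` only, never the summit; the YM mass gap (Clay) is NOT proved by any of this; nothing
continuum ∕ ℝ⁴ ∕ OS.  No `sorry`, no `def`, no `instance`, no `notation`.

References: [15] (44)–(48) p.285, Prop. 4 (97)–(98) pp.292–293, (152) p.301, (156)–(157) p.302; [Balaban1985Averaging] Prop. 4 (130)–(131) p.38.
-/

noncomputable section

open scoped BigOperators Topology
open NormedSpace Metric Set Filter

namespace Summit.QuantumFields.YangMills.Theorems.K0Stub1QlinSupLetter

open Literature.MathematicalPhysics.QuantumFieldTheory.Balaban1983to89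
open Literature.MathematicalPhysics.QuantumFieldTheory.Balaban1983to89.B6SectADomainsV1 (Domains)
open Literature.MathematicalPhysics.QuantumFieldTheory.Balaban1983to89.B6SectAOperatorsV1 (BondIdx)
open Summit.QuantumFields.YangMills.Theorems.FlatCubeOpsText (Adm22)
open Summit.QuantumFields.YangMills.Theorems.K0FlatCubeOpsTextP (IsLevWeight)
open Summit.QuantumFields.YangMills.Theorems.Prop8Chart (chartLog chartLog_zero collar_of_adm22)
open Summit.QuantumFields.YangMills.BalabanUVNodes.N07ChartRemainderP (norm_chartLog_le_weightedBall)
open Summit.QuantumFields.YangMills.BalabanUVNodes.N07ChartLogAnalytic (analyticOnNhd_chartLog_weightedBall)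

variable {P : Params} {𝔸 : Type*} [NormedRing 𝔸] [NormedAlgebra ℂ 𝔸] [CompleteSpace 𝔸] [NormOneClass 𝔸]

/-- ★★ **THE k-UNIFORM SUP LETTER OF THE TRUE LINEARISED AVERAGE**: for a nested family `D` with `D.k = k` and the collar property and the level weights `w`,
`‖(fderiv ℂ (chartLog η D) 0) A′ idx‖ ≤ 240ℓL·r` at every index whenever `w 1 b·‖A′ b‖ ≤ r` at every bond (`η = L^{−k}`, `ℓ = (d+2)L`) — the derivative along the line
`s ↦ s·A′` of dag-n07-w2's bound `‖chartLog η D A‖ ≤ 120ℓL·R` on the weighted ball of (shrinking) radius `R_s = |s|(2r + |s|)`.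
[cite: Balaban1985Variational, (44)-(45) p.285, (152) p.301; Balaban1985Averaging, Prop. 4 (130)-(131) p.38] -/
theorem norm_fderiv_chartLog_zero_apply_le (k : ℕ) (D : Domains P) (hDk : D.k = k)
    (hcollar : ∀ (i : ℕ) (e : PBond P (i + 1)), D.LamBond (i + 1) e → ∀ z : Site P i, (blockOf z = e.src ∨ blockOf z = e.tgt) → z ∈ D.Om i)
    {w : ℕ → PBond P 0 → ℝ} (hw : IsLevWeight P k D w) (A' : PBond P 0 → 𝔸) {r : ℝ} (hA' : ∀ b, w 1 b * ‖A' b‖ ≤ r) (idx : BondIdx D) :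
    ‖(fderiv ℂ (chartLog (((P.L : ℝ)⁻¹) ^ k) D : (PBond P 0 → 𝔸) → BondIdx D → 𝔸) 0) A' idx‖ ≤
      240 * (((P.d + 2) * P.L : ℕ) : ℝ) * (P.L : ℝ) * r := by
  -- letters
  set η : ℝ := ((P.L : ℝ)⁻¹) ^ k with hη
  set ℓ : ℝ := (((P.d + 2) * P.L : ℕ) : ℝ) with hℓ
  have hL0 : (0 : ℝ) < P.L := by exact_mod_cast P.L_pos
  have hℓ1 : (1 : ℝ) ≤ ℓ := by
    rw [hℓ]; exact_mod_cast Nat.one_le_iff_ne_zero.mpr (Nat.mul_ne_zero (by omega) (by have := P.hL.2; omega))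
  have hden : 0 < 12800 * ℓ ^ 2 * (P.L : ℝ) := by positivity
  have hwpos : ∀ b, 0 < w 1 b := fun b => by rw [hw 1 b, pow_one]; positivity
  -- `0 ≤ r` (the index bond provides a fine bond)
  have hr0 : 0 ≤ r := le_trans (mul_nonneg (hwpos ⟨fun _ => 0, idx.1.2.dir⟩).le (norm_nonneg _)) (hA' _)
  set Qlin : (PBond P 0 → 𝔸) →L[ℂ] (BondIdx D → 𝔸) :=
    fderiv ℂ (chartLog η D : (PBond P 0 → 𝔸) → BondIdx D → 𝔸) 0 with hQlin
  -- the charted constraint is differentiable at `0` (analytic on any admissible weighted ball containing `0`)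
  set R₀ : ℝ := (12800 * ℓ ^ 2 * (P.L : ℝ))⁻¹ with hR₀
  have hR₀0 : 0 < R₀ := inv_pos.mpr hden
  have hR₀1 : 12800 * (((P.d + 2) * P.L : ℕ) : ℝ) ^ 2 * (P.L : ℝ) * R₀ ≤ 1 := by
    rw [hR₀, ← hℓ, mul_inv_cancel₀ hden.ne']
  have h0mem : (0 : PBond P 0 → 𝔸) ∈ {Y : PBond P 0 → 𝔸 | ∀ b, w 1 b * ‖Y b‖ < R₀} := fun b => by
    simp only [Pi.zero_apply, norm_zero, mul_zero]; exact hR₀0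
  have hdiff : HasFDerivAt (chartLog η D : (PBond P 0 → 𝔸) → BondIdx D → 𝔸) Qlin 0 :=
    ((analyticOnNhd_chartLog_weightedBall (𝔸 := 𝔸) k D hDk hcollar hw hR₀1) 0 h0mem).differentiableAt.hasFDerivAt
  -- the complex line `s ↦ s·A′` and the component `idx`
  set G : ℂ → 𝔸 := fun s => chartLog η D (s • A') idx with hG
  have hline : HasDerivAt (fun s : ℂ => s • A') A' 0 := by
    have h := (hasDerivAt_id' (0 : ℂ)).smul_const A'
    rw [one_smul] at h
    exact h
  have hcomp : HasDerivAt (fun s : ℂ => chartLog η D (s • A')) (Qlin A') 0 := by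
    have h0 : (0 : ℂ) • A' = 0 := zero_smul _ _
    have hd : HasFDerivAt (chartLog η D : (PBond P 0 → 𝔸) → BondIdx D → 𝔸) Qlin ((fun s : ℂ => s • A') 0) := by
      simpa only [h0] using hdiff
    exact hd.comp_hasDerivAt 0 hline
  have hGd : HasDerivAt G (Qlin A' idx) 0 :=
    ((ContinuousLinearMap.proj (R := ℂ) (φ := fun _ : BondIdx D => 𝔸) idx).hasFDerivAt).comp_hasDerivAt 0 hcomp
  have hG0 : G 0 = 0 := by
    simp only [hG, zero_smul, chartLog_zero, Pi.zero_apply]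
  -- the difference quotient tends to `Qlin A′ idx`
  have hslope : Tendsto (fun s : ℂ => s⁻¹ • (G (0 + s) - G 0)) (𝓝[≠] 0) (𝓝 (Qlin A' idx)) := hGd.tendsto_slope_zero
  have hnorm : Tendsto (fun s : ℂ => ‖s⁻¹ • (G (0 + s) - G 0)‖) (𝓝[≠] 0) (𝓝 ‖Qlin A' idx‖) := hslope.norm
  -- the bound `120ℓL(2r + |s|)` along the line, eventually
  have hbound : ∀ᶠ s : ℂ in 𝓝[≠] 0, ‖s⁻¹ • (G (0 + s) - G 0)‖ ≤ 120 * ℓ * (P.L : ℝ) * (2 * r + ‖s‖) := by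
    -- a radius `δ ≤ 1` with `12800ℓ²L·δ(2r+1) ≤ 1`
    set δ : ℝ := min 1 (12800 * ℓ ^ 2 * (P.L : ℝ) * (2 * r + 1))⁻¹ with hδ
    have hδ0 : 0 < δ := lt_min one_pos (inv_pos.mpr (by positivity))
    have hsmall' : ∀ᶠ s : ℂ in 𝓝 0, ‖s‖ < δ :=
      Metric.eventually_nhds_iff.mpr ⟨δ, hδ0, fun y hy => by simpa only [dist_zero_right] using hy⟩
    have hsmall : ∀ᶠ s : ℂ in 𝓝[≠] 0, ‖s‖ < δ := eventually_nhdsWithin_of_eventually_nhds hsmall'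
    have hne : ∀ᶠ s : ℂ in 𝓝[≠] 0, s ≠ 0 := self_mem_nhdsWithin
    filter_upwards [hsmall, hne] with s hs hs0
    have hspos : 0 < ‖s‖ := norm_pos_iff.mpr hs0
    -- the radius `R_s = |s|(2r + |s|)` is admissible and contains `s·A′`
    set Rs : ℝ := ‖s‖ * (2 * r + ‖s‖) with hRs
    have hRs_adm : 12800 * (((P.d + 2) * P.L : ℕ) : ℝ) ^ 2 * (P.L : ℝ) * Rs ≤ 1 := by
      rw [← hℓ]
      have hδ1 : δ ≤ 1 := min_le_left _ _
      have hδ2 : δ ≤ (12800 * ℓ ^ 2 * (P.L : ℝ) * (2 * r + 1))⁻¹ := min_le_right _ _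
      have h1 : Rs ≤ δ * (2 * r + 1) := by
        rw [hRs]
        have : 2 * r + ‖s‖ ≤ 2 * r + 1 := by linarith
        exact mul_le_mul hs.le this (by positivity) hδ0.le
      have h2 : 12800 * ℓ ^ 2 * (P.L : ℝ) * (δ * (2 * r + 1)) ≤ 1 := by
        have h3 : δ * (2 * r + 1) ≤ (12800 * ℓ ^ 2 * (P.L : ℝ) * (2 * r + 1))⁻¹ * (2 * r + 1) :=
          mul_le_mul_of_nonneg_right hδ2 (by positivity)
        calc 12800 * ℓ ^ 2 * (P.L : ℝ) * (δ * (2 * r + 1))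
            ≤ 12800 * ℓ ^ 2 * (P.L : ℝ) * ((12800 * ℓ ^ 2 * (P.L : ℝ) * (2 * r + 1))⁻¹ * (2 * r + 1)) :=
              mul_le_mul_of_nonneg_left h3 (by positivity)
          _ = 1 := by field_simp
      exact le_trans (mul_le_mul_of_nonneg_left h1 (by positivity)) h2
    have hmem : ∀ b, w 1 b * ‖(s • A') b‖ < Rs := fun b => by
      rw [Pi.smul_apply, norm_smul, mul_left_comm]
      have h1 : ‖s‖ * (w 1 b * ‖A' b‖) ≤ ‖s‖ * r := mul_le_mul_of_nonneg_left (hA' b) (norm_nonneg _)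
      have h2 : ‖s‖ * r < Rs := by rw [hRs]; exact mul_lt_mul_of_pos_left (by linarith) hspos
      exact h1.trans_lt h2
    have hval : ‖G s‖ ≤ 120 * ℓ * (P.L : ℝ) * Rs := by
      have h := norm_chartLog_le_weightedBall (𝔸 := 𝔸) k D hDk hcollar hw hRs_adm hmem idx
      rw [← hℓ] at h
      exact h
    rw [zero_add, hG0, sub_zero, norm_smul, norm_inv]
    calc ‖s‖⁻¹ * ‖G s‖ ≤ ‖s‖⁻¹ * (120 * ℓ * (P.L : ℝ) * Rs) := mul_le_mul_of_nonneg_left hval (by positivity)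
      _ = 120 * ℓ * (P.L : ℝ) * (2 * r + ‖s‖) := by rw [hRs]; field_simp
  -- the bound tends to `240ℓL·r`
  have hlim : Tendsto (fun s : ℂ => 120 * ℓ * (P.L : ℝ) * (2 * r + ‖s‖)) (𝓝[≠] 0) (𝓝 (240 * ℓ * (P.L : ℝ) * r)) := by
    have hc : Continuous fun s : ℂ => 120 * ℓ * (P.L : ℝ) * (2 * r + ‖s‖) := by fun_prop
    have h := (hc.tendsto (0 : ℂ)).mono_left (nhdsWithin_le_nhds (s := ({0}ᶜ : Set ℂ)))
    have heq : 120 * ℓ * (P.L : ℝ) * (2 * r + ‖(0 : ℂ)‖) = 240 * ℓ * (P.L : ℝ) * r := by rw [norm_zero]; ring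
    rwa [heq] at h
  have h := le_of_tendsto_of_tendsto hnorm hlim hbound
  simpa only [hℓ] using h

/-- The same with the collar property discharged from (2.2)-admissibility (`Adm22 D R′ M`, `2L ≤ R′·M + 1`). [cite: Balaban1984PropagatorsII, (2.2) p.224; Balaban1985Variational, (45) p.285] -/
theorem norm_fderiv_chartLog_zero_apply_le_of_adm22 (k : ℕ) (D : Domains P) (hDk : D.k = k) {R' M : ℕ} (hAdm : Adm22 D R' M)
    (hRM : 2 * P.L ≤ R' * M + 1) {w : ℕ → PBond P 0 → ℝ} (hw : IsLevWeight P k D w)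
    (A' : PBond P 0 → 𝔸) {r : ℝ} (hA' : ∀ b, w 1 b * ‖A' b‖ ≤ r) (idx : BondIdx D) :
    ‖(fderiv ℂ (chartLog (((P.L : ℝ)⁻¹) ^ k) D : (PBond P 0 → 𝔸) → BondIdx D → 𝔸) 0) A' idx‖ ≤
      240 * (((P.d + 2) * P.L : ℕ) : ℝ) * (P.L : ℝ) * r :=
  norm_fderiv_chartLog_zero_apply_le k D hDk (collar_of_adm22 D hAdm hRM) hw A' hA' idx

/-- ★★ **THE CAPSTONE's `hQ` AT `Q := Qlin`, VERBATIM** (block weight `1`, `q := 240ℓL`): for a (2.2)-admissible nested family (`2L ≤ R′`, `1 ≤ M`, as in dag-n07-w2's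
files), `∀ A′ r, (∀ b, w 1 b·‖A′ b‖ ≤ r) → ∀ i, 1·‖Qlin A′ i‖ ≤ (240ℓL)·r` — the hypothesis `hQ` of `K0Stub1SectFWSlotOneLevel.exists_sectF_W_levOf` («the average: `q·r`»)
for the true linearised constraint. [cite: Balaban1985Variational, (45) p.285, Prop. 4 (97)-(98) pp.292-293] -/
theorem letterQ_Qlin_of_adm22 (k : ℕ) {R' M : ℕ} (hR'L : 2 * P.L ≤ R') (hM : 1 ≤ M) (D : Domains P) (hDk : D.k = k) (hAdm : Adm22 D R' M)
    {w : ℕ → PBond P 0 → ℝ} (hw : IsLevWeight P k D w) :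
    ∀ (A' : PBond P 0 → 𝔸) (r : ℝ), (∀ b, w 1 b * ‖A' b‖ ≤ r) →
      ∀ i : BondIdx D, (fun _ : BondIdx D => (1 : ℝ)) i *
        ‖(fderiv ℂ (chartLog (((P.L : ℝ)⁻¹) ^ k) D : (PBond P 0 → 𝔸) → BondIdx D → 𝔸) 0) A' i‖ ≤
        (240 * (((P.d + 2) * P.L : ℕ) : ℝ) * (P.L : ℝ)) * r := by
  intro A' r hA' i
  have hRM : 2 * P.L ≤ R' * M + 1 := by have : R' ≤ R' * M := Nat.le_mul_of_pos_right R' hM; omega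
  rw [one_mul]
  exact norm_fderiv_chartLog_zero_apply_le_of_adm22 k D hDk hAdm hRM hw A' hA' i

end Summit.QuantumFields.YangMills.Theorems.K0Stub1QlinSupLetter

end
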